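import Summits.AtomisticToContinuum.Crystallization.Theorems.FluxTubeKeplerFloorGivesLayered
import Summits.AtomisticToContinuum.Crystallization.Theorems.FluxTubeKeplerFluxCellKeplerSingleScale
import Summits.AtomisticToContinuum.Crystallization.Theorems.ChessboardParticlePlanesPeriodicWindowsIffCrystallization
import Summits.AtomisticToContinuum.Crystallization.Theorems.FluxTubeKeplerKeplerEnergyFloor

/-!
# Line `GrainBlindRung` (grain ladder) — skeleton for the forward rung over `FluxTubeKepler.FloorGivesLayered`
(crux dir `FluxCellKepler`, stmt-AtomisticToContinuum-15221; fwd-rung G1 gen 6, seed g1-AtomisticToContinuum-15223)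

FLOOR (proved, `FluxTubeKeplerFloorGivesLayered.FloorGivesLayered_proof`): for every periodic `P₀`, the energy
floor `N·e(P₀) ≤ E(x)` on Lennard-Jones ground states together with the defect BUDGET — at every scale `(R,η)` some
`c > 0` prices every site whose `R`-neighbourhood is not two-way `η`-close to ONE admissible layered template (ONE rigid
frame `A`, spacing `a ∈ [47/50, 1]`, Hägg word, Barlow registry, interlayer gaps in `[39a/50, 17a/20]`) — forces
layered windows, hence (proved `PeriodicGivenLayered`) periodic windows, along every ground-state sequence.

RUNG (`GrainBlindRung := ∃ κ > 0, GrainRung κ`): for SOME grain fineness `κ > 0` the budget need only price the sites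
whose `R`-neighbourhood is not two-way `η`-close to a POLYCRYSTAL of admissible layered grains — finitely many convex cells
(the maximality cells of finitely many distinct affine functions), each filled by ITS OWN rigid admissible layered grain
`A_j(S_j) + τ_j`, every cell `1/κ`-fat (each of its points lies within `2r` of a ball of radius `r ≥ 1/κ` inside the cell).  A Kepler-type certificate
then never has to charge a site for the ORIENTATION TEXTURE of the perfect material around it (clean large-angle grain
boundaries, triple lines and quadruple points between fat grains are free); single-frame order is selected by the energy
(grain-boundary tension ⇒ grain coarsening along ground states).  Dial `GrainRung κ` (`κ ≥ 0` the admissible grain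
FINENESS: cells must be `1/κ`-fat): `GrainRung 0` is the floor (`grainRung_zero`, F3: no cell is `1/0`-fat, so the
polycrystal disjunct is void and `GrainGood 0 = LayeredGood`), antitone dial `grainRung_anti` (harder-to-easier =
decreasing `κ`; the deciding rung is the first member above the floor, `∃ κ > 0` — no hand-picked fineness), on-path
`grainRung_of_crystallization` / `GrainBlindRung_of_Crystallization` (F4, landed iff `periodicWindows_of_crystallization`);
the Statement gives every member, and any member together with the relieved parent package at its own fineness gives the
Statement (`crystallization_of_grainRung`; with the parent crux: `crystallization_of_grainBlindRung_of_fluxCellKepler`).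

WHY THE FLOOR'S PROOF STOPS: Step 1 of the seed (`eventually_exists_not_bad`, o(N) counting) now yields sites whose
`R`-ball is a clean POLYCRYSTAL, not a single-frame window; Steps 2–3 (`spacing_selection`, `match_dilate`) and the proved
`PeriodicGivenLayered` need single-frame layered windows.  No potential-free repair exists: for every `κ > 0` the ideal
polycrystal with cubic grains of side `4/κ` in generic orientations is `κ`-grain-good at EVERY site and EVERY scale and
layered-good at no site for `R > 8/κ`, so counting alone never produces a single-frame site (whereas every bounded-grain-COUNT
or scale-RELATIVE version of the dial IS flat: a clean polycrystalline ball with boundedly many fat cells contains a clean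
single-grain sub-ball — Bang's plank theorem — which is why the dial is the ABSOLUTE fatness `1/κ`).  The missing
input is ENERGY: the interfacial (grain-boundary) tension of rigid Lennard-Jones polycrystals.

THE LINE (three stubs, the only `sorry`s; composition `GrainBlindRung_of` sorry-free):
* `stub_grainTension` (THE NEW INPUT, configuration-free lattice-sum inequality — GRAIN-BOUNDARY TENSION): for some
  fineness `κ > 0` and every tolerance `η₁ > 0` there are `g₀ > 0`, `C` with: every `1/κ`-fat polycrystal template `T`
  and every finite window `W ⊆ T` satisfy `Σ_{p∈W} e_p(T) ≥ 2e⋆·#W + 2g₀·#{p ∈ W : T is not η₁-single-frame on the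
  3-ball of p} − C·∂W`, in the window-bound currency of the sibling lines (`e⋆ = eStar`; the junction predicate is the
  radius-`3` copy `SetLayeredNearR` of the landed `SetLayeredNear`).
* `stub_junctionTransfer` (potential-free geometry, the cheap end): inside a polycrystal-good ball, a particle matched
  to a template point at which the template IS single-frame on the 3-ball is `(2, 2(η₁+η'))`-layered-good (re-anchoring
  at the matched lattice point: `layeredPos_shift`, `InBox.shift`, `isHaggSeq_shift`).
* `stub_grainCoarsening` (Lennard-Jones block accounting along ground states; load-bearing): given the two previous
  statements at a fineness `κ > 0`, along a ground-state sequence whose `κ`-grain-blind defects are sparse at every scale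
  the radius-`2` single-frame defects are sparse too (`E(x_N) ≤ N·e⋆ + o(N)` by `crysEnergyLimit`; junction sites pay
  `g₀` each by the tension inequality; so junction sites are `o(N)`: GRAIN COARSENING).
Glue (proved here): `not_polyGood_zero` / `grainGood_zero_iff` (F3 rewriting), `polyGood_of_layeredGood` (for `κ > 0`
the disjunction collapses: one-cell template), monotonicity in `κ`,
`fewGrainBad_of_budget` (counting, as the seed's `eventually_exists_not_bad` with a density `θ`), `good_of_sparse`
(landed chart gluing `FluxCellKeplerSingleScale.card_bad_le` + `LennardJonesMinimalDistance_holds`, verbatim from the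
sibling lines `Lines/RegistryBlindRung.lean`, `Lines/ScaleBlindRung.lean`), `hasLayeredWindows_of_good` (Steps 2–3 of
the seed, verbatim from the sibling lines), proved `PeriodicGivenLayered`.
-/

noncomputable section

namespace Summit.AtomisticToContinuum.Crystallization.Cruxes.FluxCellKepler.GrainLadder

open scoped BigOperators Classical
open Filter Topology
open Literature.MathematicalPhysics.StatisticalMechanics
open Summit.AtomisticToContinuum.Crystallization.Theorems.FluxCellKeplerSingleScale
  (LayeredGood layeredGood_mono card_bad_le)
open Summit.AtomisticToContinuum.Crystallization.Theorems.ChargedEnergyGapNegative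
  (eStar card_mul_eStar_le crysEnergyLimit)
open Summit.AtomisticToContinuum.Crystallization.Theorems.PrestressSplitKorn
  (SetLayeredNear layeredPos InBox)

local notation "E3" => EuclideanSpace ℝ (Fin 3)

/-- FLOOR(P₀): `N · e(P₀) ≤ E(x)` for every Lennard-Jones ground state (verbatim the floor's first hypothesis). -/
def Floor (P₀ : PeriodicConfiguration 3) : Prop :=
  ∀ (N : ℕ) (x : Fin N → E3), IsGroundState lennardJones x →
    (N : ℝ) * P₀.energyPerParticle lennardJones ≤ interactionEnergy lennardJones x

/-- **Polycrystal template**: `k` convex CELLS — the maximality cells `{p | ∀ j', ⟪n j', p⟫ + t j' ≤ ⟪n j, p⟫ + t j}`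
of `k` pairwise distinct affine functions `p ↦ ⟪n j, p⟫ + t j` (half-spaces, slabs, wedges of dihedral angle `≥ 60°` once fat,
power / Voronoi diagrams …; they cover space when `k ≥ 1`, and two distinct cells meet in a plane at most) — the cell `j`
filled by its OWN rigid admissible layered GRAIN `A j (layeredPos (a j) (s j) (z j) ·) + τ j` (spacing and interlayer gaps
in the floor's box `InBox`, Hägg word `s j`, linear isometry `A j`, arbitrary translation `τ j`).  One cell (`k = 1`,
`n = 0`, `t = 0`) is a single admissible layered set. -/
structure PolyTemplate where
  /-- number of cells / grains -/
  k : ℕ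
  /-- gradients of the affine functions defining the cells -/
  n : Fin k → E3
  /-- offsets of the affine functions defining the cells -/
  t : Fin k → ℝ
  /-- translation of grain `j` -/
  τ : Fin k → E3
  /-- in-plane spacing of grain `j` -/
  a : Fin k → ℝ
  /-- frame of grain `j` -/
  A : Fin k → (E3 →ₗᵢ[ℝ] E3)
  /-- Hägg word of grain `j` -/
  s : Fin k → ℤ → ℤ
  /-- layer heights of grain `j` -/
  z : Fin k → ℤ → ℝ
  /-- every grain is an admissible layered set (the floor's box) -/
  box : ∀ j, InBox (a j) (z j) ∧ IsHaggSeq (s j)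
  /-- the affine functions are pairwise distinct (so distinct cells overlap in a plane at most: no multiply-filled
  cell; with fatness this bounds the local density of the polycrystal) -/
  nodup : Function.Injective fun j => (n j, t j)

namespace PolyTemplate

/-- Cell `j`: where the `j`-th affine function is maximal (a closed convex polyhedron). -/
def cell (T : PolyTemplate) (j : Fin T.k) : Set E3 :=
  {p | ∀ j' : Fin T.k, inner ℝ (T.n j') p + T.t j' ≤ inner ℝ (T.n j) p + T.t j}

/-- Grain `j`: the rigid admissible layered set `A j (layeredPos …) + τ j`. -/
def grain (T : PolyTemplate) (j : Fin T.k) : Set E3 :=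
  {p | ∃ l : ℤ × ℤ × ℤ, p = T.A j (layeredPos (T.a j) (T.s j) (T.z j) l) + T.τ j}

/-- The polycrystal: cell `j` carries grain `j`. -/
def carrier (T : PolyTemplate) : Set E3 :=
  {p | ∃ j : Fin T.k, p ∈ T.cell j ∧ p ∈ T.grain j}

/-- `1/κ`-FATNESS of the cells (`κ ≥ 0` the grain fineness): every point of every cell lies within `2r` of the centre
of a ball of radius `r`, `κ·r ≥ 1`, contained in the cell.  `κ = 0`: no cell qualifies (`1 ≤ 0·r` is false). -/
def Fat (T : PolyTemplate) (κ : ℝ) : Prop :=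
  ∀ (j : Fin T.k) (p : E3), p ∈ T.cell j →
    ∃ (q : E3) (r : ℝ), 1 ≤ κ * r ∧ dist p q ≤ 2 * r ∧ Metric.closedBall q r ⊆ T.cell j

end PolyTemplate

/-- The `R`-ball of relative positions around `x i` is two-way `η`-matched with the `1/κ`-fat polycrystal template `T`. -/
def PolyGoodVia (κ R η : ℝ) {N : ℕ} (x : Fin N → E3) (i : Fin N) (T : PolyTemplate) : Prop :=
  T.Fat κ ∧
    (∀ p ∈ T.carrier, ‖p‖ ≤ R → ∃ j : Fin N, dist (x j - x i) p ≤ η) ∧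
    (∀ j : Fin N, ‖x j - x i‖ ≤ R → ∃ p ∈ T.carrier, dist (x j - x i) p ≤ η)

/-- `κ`-POLYCRYSTAL-GOOD site: some `1/κ`-fat polycrystal template matches the `R`-ball around `x i` two-way with
tolerance `η`. -/
def PolyGood (κ R η : ℝ) {N : ℕ} (x : Fin N → E3) (i : Fin N) : Prop :=
  ∃ T : PolyTemplate, PolyGoodVia κ R η x i T

/-- `κ`-GRAIN-GOOD site: layered-good (the floor's predicate, verbatim by name) OR `κ`-polycrystal-good.
`κ = 0`: the floor's predicate (`grainGood_zero_iff`); `κ = 1/2`: clean polycrystals of `2`-fat grains are good. -/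
def GrainGood (κ R η : ℝ) {N : ℕ} (x : Fin N → E3) (i : Fin N) : Prop :=
  LayeredGood R η x i ∨ PolyGood κ R η x i

/-- GRAIN-BLIND BUDGET with dial `κ`: at every scale `(R,η)` some `c > 0` prices the sites that are not `κ`-grain-good
against the excess energy over `N · e(P₀)` (`κ = 0`: the floor's budget; the crux's quantifier order `∀ R η, ∃ c`). -/
def GrainBudget (κ : ℝ) (P₀ : PeriodicConfiguration 3) : Prop :=
  ∀ R η : ℝ, 0 < R → 0 < η → ∃ c : ℝ, 0 < c ∧
    ∀ (N : ℕ) (x : Fin N → E3), IsGroundState lennardJones x →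
      c * (Nat.card {i : Fin N // ¬ GrainGood κ R η x i} : ℝ) ≤
        interactionEnergy lennardJones x - (N : ℝ) * P₀.energyPerParticle lennardJones

/-- Periodic windows at every scale along `x` (verbatim the conclusion of `FluxTubeKepler.PeriodicGivenLayered`). -/
def HasPeriodicWindows (x : (N : ℕ) → (Fin N → E3)) : Prop :=
  ∃ P : PeriodicConfiguration 3, ∀ R ε : ℝ, 0 < ε → ∃ᶠ N in atTop, ∃ t : E3,
    (∀ s ∈ P.points, ‖s‖ ≤ R → ∃ i : Fin N, dist (x N i + t) s ≤ ε) ∧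
    (∀ i : Fin N, ‖x N i + t‖ ≤ R → ∃ s ∈ P.points, dist (x N i + t) s ≤ ε)

/-- **The graded family.** `GrainRung κ`: FLOOR and the budget that leaves clean `1/κ`-fat polycrystalline sites
unpriced force periodic windows along every Lennard-Jones ground-state sequence. -/
def GrainRung (κ : ℝ) : Prop :=
  ∀ P₀ : PeriodicConfiguration 3, Floor P₀ → GrainBudget κ P₀ →
    ∀ x : (N : ℕ) → (Fin N → E3), (∀ N, IsGroundState lennardJones (x N)) → HasPeriodicWindows x

/-- **Deciding rung.** For SOME positive fineness `κ` the budget need not price ORIENTATION TEXTURE above the grain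
size `2/κ`: pricing only the sites whose `R`-neighbourhood is not `η`-close to some polycrystal of `1/κ`-fat admissible
layered grains (any number of grains, any frames, any fat convex cells) suffices — the single frame of the windows is then
selected by the energy (grain-boundary tension ⇒ coarsening).  (`∃ κ > 0`, not a hand-picked fineness: the first member
of the dial above the floor `κ = 0`; every member is a real step — the ideal polycrystal with cubic `1/κ`-fat grains in
generic orientations is `κ`-grain-good at every site and scale and layered-good at none.) -/
def GrainBlindRung : Prop := ∃ κ : ℝ, 0 < κ ∧ GrainRung κ

/-! ## Predicate bookkeeping -/

/-- No cell is `1/0`-fat: at fineness `κ = 0` no site is polycrystal-good (for `R ≥ 0`). -/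
theorem not_polyGood_zero {R η : ℝ} (hR : 0 ≤ R) {N : ℕ} (x : Fin N → E3) (i : Fin N) :
    ¬ PolyGood 0 R η x i := by
  rintro ⟨T, hfat, -, h₂⟩
  obtain ⟨p, hp, -⟩ := h₂ i (by simp [hR])
  obtain ⟨j, hj, -⟩ := hp
  obtain ⟨q, r, h1, -, -⟩ := hfat j p hj
  norm_num at h1

/-- The floor's predicate is the member `κ = 0` of the family. -/
theorem grainGood_zero_iff {R η : ℝ} (hR : 0 ≤ R) {N : ℕ} (x : Fin N → E3) (i : Fin N) :
    GrainGood 0 R η x i ↔ LayeredGood R η x i :=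
  ⟨fun h => h.elim id fun hP => (not_polyGood_zero hR x i hP).elim, Or.inl⟩

theorem fat_mono {κ κ' : ℝ} (hκ : κ ≤ κ') (T : PolyTemplate) : T.Fat κ → T.Fat κ' := by
  intro h j p hp
  obtain ⟨q, r, h1, h2, h3⟩ := h j p hp
  have hr : 0 ≤ r := by linarith [dist_nonneg (x := p) (y := q)]
  exact ⟨q, r, h1.trans (mul_le_mul_of_nonneg_right hκ hr), h2, h3⟩

theorem polyGood_mono {κ κ' : ℝ} (hκ : κ ≤ κ') {R η : ℝ} {N : ℕ} (x : Fin N → E3) (i : Fin N) :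
    PolyGood κ R η x i → PolyGood κ' R η x i := by
  rintro ⟨T, hfat, h₁, h₂⟩
  exact ⟨T, fat_mono hκ T hfat, h₁, h₂⟩

theorem grainGood_mono {κ κ' : ℝ} (hκ : κ ≤ κ') {R η : ℝ} {N : ℕ} (x : Fin N → E3) (i : Fin N) :
    GrainGood κ R η x i → GrainGood κ' R η x i :=
  fun h => h.elim Or.inl fun hP => Or.inr (polyGood_mono hκ x i hP)

/-- `GrainGood κ` is antitone in the radius and monotone in the tolerance. [folklore] -/
theorem polyGood_mono_scale {κ R R' η η' : ℝ} (hR : R ≤ R') (hη : η' ≤ η) {N : ℕ}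
    (x : Fin N → E3) (i : Fin N) : PolyGood κ R' η' x i → PolyGood κ R η x i := by
  rintro ⟨T, hfat, h₁, h₂⟩
  refine ⟨T, hfat, ?_, ?_⟩
  · intro p hp hpR
    obtain ⟨j, hj⟩ := h₁ p hp (hpR.trans hR)
    exact ⟨j, hj.trans hη⟩
  · intro j hj
    obtain ⟨p, hp, hjp⟩ := h₂ j (hj.trans hR)
    exact ⟨p, hp, hjp.trans hη⟩

/-- The ONE-CELL template (`k = 1`, `n = 0`, `t = 0`, `τ = 0`) of an admissible layered set. -/
def oneCell (a : ℝ) (A : E3 →ₗᵢ[ℝ] E3) (s : ℤ → ℤ) (z : ℤ → ℝ) (h : InBox a z ∧ IsHaggSeq s) :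
    PolyTemplate where
  k := 1
  n := fun _ => 0
  t := fun _ => 0
  τ := fun _ => 0
  a := fun _ => a
  A := fun _ => A
  s := fun _ => s
  z := fun _ => z
  box := fun _ => h
  nodup := fun _ _ _ => Subsingleton.elim _ _

theorem oneCell_cell (a : ℝ) (A : E3 →ₗᵢ[ℝ] E3) (s : ℤ → ℤ) (z : ℤ → ℝ) (h : InBox a z ∧ IsHaggSeq s)
    (j : Fin 1) : (oneCell a A s z h).cell j = Set.univ := by
  ext p
  simp [PolyTemplate.cell, oneCell]

theorem oneCell_carrier (a : ℝ) (A : E3 →ₗᵢ[ℝ] E3) (s : ℤ → ℤ) (z : ℤ → ℝ) (h : InBox a z ∧ IsHaggSeq s) :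
    (oneCell a A s z h).carrier = {p | ∃ l : ℤ × ℤ × ℤ, p = A (layeredPos a s z l)} := by
  ext p
  have hc : ∀ j, p ∈ (oneCell a A s z h).cell j := fun j => by rw [oneCell_cell]; trivial
  simp only [PolyTemplate.carrier, PolyTemplate.grain, Set.mem_setOf_eq]
  constructor
  · rintro ⟨j, -, l, hl⟩
    exact ⟨l, by simpa [oneCell] using hl⟩
  · rintro ⟨l, rfl⟩
    exact ⟨⟨0, Nat.one_pos⟩, hc _, l, by simp [oneCell]⟩

/-- For a POSITIVE fineness the disjunction collapses: a layered-good site is `κ`-polycrystal-good for the one-cell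
template (the whole space is one `1/κ`-fat cell).  So `GrainGood κ = PolyGood κ` for `κ > 0`, while `GrainGood 0 =
LayeredGood`. [folklore] -/
theorem polyGood_of_layeredGood {κ : ℝ} (hκ : 0 < κ) {R η : ℝ} {N : ℕ} (x : Fin N → E3) (i : Fin N) :
    LayeredGood R η x i → PolyGood κ R η x i := by
  rintro ⟨a, ha₁, ha₂, A, s, z, hs, hz, h₁, h₂⟩
  refine ⟨oneCell a A s z ⟨⟨ha₁, ha₂, hz⟩, hs⟩, ?_, ?_, ?_⟩
  · intro j p _
    refine ⟨p, 1 / κ, ?_, ?_, ?_⟩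
    · rw [mul_one_div_cancel hκ.ne']
    · rw [dist_self]; positivity
    · rw [oneCell_cell]; exact Set.subset_univ _
  · intro p hp hpR
    rw [oneCell_carrier] at hp
    obtain ⟨l, rfl⟩ := hp
    exact h₁ _ ⟨l.1, l.2.1, l.2.2, rfl⟩ hpR
  · intro j hj
    obtain ⟨p, ⟨m, k, l, rfl⟩, hjp⟩ := h₂ j hj
    refine ⟨_, ?_, hjp⟩
    rw [oneCell_carrier]
    exact ⟨(m, k, l), rfl⟩

theorem grainGood_iff_polyGood {κ : ℝ} (hκ : 0 < κ) {R η : ℝ} {N : ℕ} (x : Fin N → E3) (i : Fin N) :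
    GrainGood κ R η x i ↔ PolyGood κ R η x i :=
  ⟨fun h => h.elim (polyGood_of_layeredGood hκ x i) id, Or.inr⟩

/-- The budget is monotone in the dial: a budget pricing the larger bad set prices the smaller one. -/
theorem grainBudget_mono {κ κ' : ℝ} (hκ : κ ≤ κ') (P₀ : PeriodicConfiguration 3) :
    GrainBudget κ P₀ → GrainBudget κ' P₀ := by
  intro hB R η hR hη
  obtain ⟨c, hc, hcB⟩ := hB R η hR hη
  refine ⟨c, hc, fun N x hx => le_trans ?_ (hcB N x hx)⟩
  have hle : Nat.card {i : Fin N // ¬ GrainGood κ' R η x i} ≤ Nat.card {i : Fin N // ¬ GrainGood κ R η x i} := by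
    rw [Nat.card_eq_fintype_card, Nat.card_eq_fintype_card]
    exact Fintype.card_subtype_mono _ _ fun i hi hg => hi (grainGood_mono hκ x i hg)
  exact mul_le_mul_of_nonneg_left (by exact_mod_cast hle) hc.le

/-! ## F3 — the family specialises to the proved floor -/

/-- `GrainRung 0` is the floor: the seed theorem followed by the proved `PeriodicGivenLayered` (the only rewriting is
`grainGood_zero_iff`: at fineness `0` the polycrystal disjunct is void). -/
theorem grainRung_zero : GrainRung 0 := by
  intro P₀ hF hB x hx
  refine Theses.FluxTubeKepler.PeriodicGivenLayered_holds x hx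
    (Theorems.FluxTubeKeplerFloorGivesLayered.FloorGivesLayered_proof P₀ hF ?_ x hx)
  intro R η hR hη
  obtain ⟨c, hc, hcB⟩ := hB R η hR hη
  refine ⟨c, hc, fun N y hy => ?_⟩
  show c * (Nat.card {i : Fin N // ¬ LayeredGood R η y i} : ℝ) ≤ _
  refine le_trans ?_ (hcB N y hy)
  have hle : Nat.card {i : Fin N // ¬ LayeredGood R η y i} ≤
      Nat.card {i : Fin N // ¬ GrainGood 0 R η y i} := by
    rw [Nat.card_eq_fintype_card, Nat.card_eq_fintype_card]
    exact Fintype.card_subtype_mono _ _ fun i hi hg => hi ((grainGood_zero_iff hR.le y i).1 hg)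
  exact mul_le_mul_of_nonneg_left (by exact_mod_cast hle) hc.le

/-! ## Dial monotonicity (harder-to-easier = decreasing the fineness `κ`) -/

theorem grainRung_anti {κ κ' : ℝ} (hκ : κ ≤ κ') : GrainRung κ' → GrainRung κ :=
  fun H P₀ hF hB x hx => H P₀ hF (grainBudget_mono hκ P₀ hB) x hx

/-- The deciding rung gives the floor member `κ = 0` (informational `specialises`). -/
theorem grainRung_zero_of_grainBlindRung (h : GrainBlindRung) : GrainRung 0 := by
  obtain ⟨κ, hκ, h⟩ := h
  exact grainRung_anti hκ.le h

/-! ## F4 — on-path lemmas: the sub-problem implies every member -/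

theorem grainRung_of_crystallization (κ : ℝ) (h : _root_.Crystallization) : GrainRung κ :=
  fun _ _ _ x hx =>
    Theorems.ChessboardParticlePlanesPeriodicWindowsIffCrystallization.periodicWindows_of_crystallization h x hx

@[aesop safe apply]
theorem GrainBlindRung_of_Crystallization (h : _root_.Crystallization) : GrainBlindRung :=
  ⟨1, one_pos, grainRung_of_crystallization 1 h⟩

/-! ## How the rung relieves the parent crux `FluxCellKepler` (documentation, sorry-free) -/

/-- The floor-and-`κ`-grain-blind-budget package (what a Kepler-type certificate that never has to charge a site for
the orientation texture of `1/κ`-fat perfect grains delivers). -/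
def GrainKeplerFloor (κ : ℝ) : Prop := ∃ P₀ : PeriodicConfiguration 3, Floor P₀ ∧ GrainBudget κ P₀

theorem grainKeplerFloor_mono {κ κ' : ℝ} (hκ : κ ≤ κ') : GrainKeplerFloor κ → GrainKeplerFloor κ' := by
  rintro ⟨P₀, hF, hB⟩
  exact ⟨P₀, hF, grainBudget_mono hκ P₀ hB⟩

theorem crystallization_of_grainRung {κ : ℝ} (h : GrainRung κ) (hK : GrainKeplerFloor κ) :
    _root_.Crystallization := by
  obtain ⟨P₀, hF, hB⟩ := hK
  exact Theorems.ChessboardParticlePlanesPeriodicWindowsIffCrystallization.crystallization_of_periodicWindows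
    (fun x hx => h P₀ hF hB x hx)

/-- The parent crux gives the package at fineness `0` (proved `KeplerEnergyFloor` + minimal distance), hence at every
`κ ≥ 0` (`grainKeplerFloor_mono`) — so `GrainBlindRung` + the parent crux decide the sub-problem. -/
theorem grainKeplerFloor_zero_of_fluxCellKepler (hK : Theses.FluxTubeKepler.FluxCellKepler) :
    GrainKeplerFloor 0 := by
  obtain ⟨P₀, hF, hB⟩ := Theorems.keplerEnergyFloor_proof hK LennardJonesMinimalDistance_holds
  refine ⟨P₀, hF, fun R η hR hη => ?_⟩
  obtain ⟨c, hc, hcB⟩ := hB R η hR hη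
  refine ⟨c, hc, fun N y hy => ?_⟩
  have hcB' : c * (Nat.card {i : Fin N // ¬ LayeredGood R η y i} : ℝ) ≤
      interactionEnergy lennardJones y - (N : ℝ) * P₀.energyPerParticle lennardJones := hcB N y hy
  refine le_trans ?_ hcB'
  have hle : Nat.card {i : Fin N // ¬ GrainGood 0 R η y i} ≤
      Nat.card {i : Fin N // ¬ LayeredGood R η y i} := by
    rw [Nat.card_eq_fintype_card, Nat.card_eq_fintype_card]
    exact Fintype.card_subtype_mono _ _ fun i hi hg => hi (Or.inl hg)
  exact mul_le_mul_of_nonneg_left (by exact_mod_cast hle) hc.le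

theorem crystallization_of_grainBlindRung_of_fluxCellKepler (h : GrainBlindRung)
    (hK : Theses.FluxTubeKepler.FluxCellKepler) : _root_.Crystallization := by
  obtain ⟨κ, hκ, h⟩ := h
  exact crystallization_of_grainRung h (grainKeplerFloor_mono hκ.le (grainKeplerFloor_zero_of_fluxCellKepler hK))


/-! ## The line: single-frame selection from energy (grain-boundary tension ⇒ grain coarsening)

Currency.  For a set `Y ⊆ ℝ³` and `p ∈ Y` the SITE ENERGY is `e_p(Y) = Σ'_{q ∈ Y, q ≠ p} V_LJ(|p − q|)` and the
boundary weight of a finite window `W ⊆ Y` is `∂W = Σ_{p∈W} (1 + dist(p, Y∖W))⁻³` — exactly the currency of the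
sibling line `Lines/ScaleBlindRung.lean` (`stub_eosGap`) and of the landed window bounds `LayeredHull.stub_windowBounds`,
with `N·e⋆ ≤ E(N)` (`card_mul_eStar_le`).  JUNCTION POINTS of a polycrystal template `T` at tolerance `η₁`: the points
`p ∈ T` at which `T` is NOT two-way `η₁`-matched on the `3`-ball with a rigid image of ONE admissible layered template —
`¬ SetLayeredNearR 3 η₁ T p`, the radius-`3` copy of the landed local predicate `PrestressSplitKorn.SetLayeredNear` of
the chart-gluing files (`setLayeredNearR_two`).  Fictitious interfaces (same grain on both sides), coherent twins (Hägg
flips) and sub-`η₁` misfits are NOT junctions; interfaces between genuinely misoriented / mis-translated / gapped /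
overlapping grains, triple lines and cell corners are. -/

/-- Radius-`ρ` version of the landed `PrestressSplitKorn.SetLayeredNear` (the case `ρ = 2`, `setLayeredNearR_two`): the
set `Z` is two-way `η`-matched on the `ρ`-ball around `q`, after the translation `t`, with a rigid image of ONE admissible
layered (box) template. -/
def SetLayeredNearR (ρ η : ℝ) (Z : Set E3) (q : E3) : Prop :=
  ∃ (A : E3 →ₗᵢ[ℝ] E3) (t : E3) (a : ℝ) (s : ℤ → ℤ) (z : ℤ → ℝ), InBox a z ∧ IsHaggSeq s ∧
    (∀ y ∈ Z, dist y q ≤ ρ → ∃ l, dist (y + t) (A (layeredPos a s z l)) ≤ η) ∧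
    (∀ l, dist (A (layeredPos a s z l)) (q + t) ≤ ρ →
      ∃ y ∈ Z, dist (y + t) (A (layeredPos a s z l)) ≤ η)

theorem setLayeredNearR_two (η : ℝ) (Z : Set E3) (q : E3) : SetLayeredNearR 2 η Z q ↔ SetLayeredNear η Z q :=
  Iff.rfl

/-- **Grain-boundary tension at fineness `κ`** (the inequality of `stub_grainTension`, as a predicate of the fineness):
for every tolerance `η₁ > 0` there are `g₀ > 0` and `C` such that every `1/κ`-fat polycrystal template `T` and every
finite window `W ⊆ T` satisfy
`Σ_{p∈W} e_p(T) ≥ 2e⋆·#W + 2g₀·#{p ∈ W : ¬ SetLayeredNearR 3 η₁ T p} − C·Σ_{p∈W} (1 + dist(p, T∖W))⁻³`. -/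
def TensionAt (κ : ℝ) : Prop :=
  ∀ η₁ : ℝ, 0 < η₁ → ∃ g₀ C : ℝ, 0 < g₀ ∧ ∀ T : PolyTemplate, T.Fat κ →
    ∀ W : Finset E3, (↑W : Set E3) ⊆ T.carrier →
      2 * eStar * (W.card : ℝ) + 2 * g₀ * ((W.filter fun p => ¬ SetLayeredNearR 3 η₁ T.carrier p).card : ℝ)
          - C * ∑ p ∈ W, (1 + Metric.infDist p (T.carrier \ (↑W : Set E3)))⁻¹ ^ 3 ≤
        ∑ p ∈ W, (∑' q : {q : E3 // q ∈ T.carrier ∧ q ≠ p}, lennardJones (dist p (q : E3)))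

/-- GRAIN-BLIND DEFECTS AT FINENESS `κ` ARE SPARSE along `x`: at every scale `(R, η)` and every density `θ > 0`,
eventually at most `θN` sites are not `κ`-grain-good (what FLOOR + the `κ`-grain-blind budget deliver,
`fewGrainBad_of_budget`). -/
def FewGrainBad (κ : ℝ) (x : (N : ℕ) → (Fin N → E3)) : Prop :=
  ∀ R η θ : ℝ, 0 < R → 0 < η → 0 < θ →
    ∀ᶠ N in atTop, (Nat.card {i : Fin N // ¬ GrainGood κ R η (x N) i} : ℝ) ≤ θ * N

/-! ### The stub statements as named propositions (verbatim; the third takes the first two as hypotheses) -/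

/-- Statement of `stub_grainTension` (verbatim; see there). [conjecture] -/
def Sig.stub_grainTension : Prop := ∃ κ : ℝ, 0 < κ ∧ TensionAt κ

/-- Statement of `stub_junctionTransfer` (verbatim; see there). [folklore] -/
def Sig.stub_junctionTransfer : Prop :=
    ∀ (κ R' η' η₁ : ℝ), 0 < η' → η' ≤ 1 / 4 → 0 < η₁ → η₁ ≤ 1 / 4 →
      ∀ (N : ℕ) (x : Fin N → E3) (i j : Fin N) (T : PolyTemplate) (p : E3),
        PolyGoodVia κ R' η' x i T → ‖x j - x i‖ + 3 ≤ R' → p ∈ T.carrier → dist (x j - x i) p ≤ η' →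
        SetLayeredNearR 3 η₁ T.carrier p → LayeredGood 2 (2 * (η₁ + η')) x j

/-- Statement of `stub_grainCoarsening` (verbatim; see there). [conjecture] -/
def Sig.stub_grainCoarsening : Prop :=
    ∀ κ : ℝ, 0 < κ → TensionAt κ → Sig.stub_junctionTransfer →
      ∀ x : (N : ℕ) → (Fin N → E3), (∀ N, IsGroundState lennardJones (x N)) → FewGrainBad κ x →
        ∀ η θ : ℝ, 0 < η → 0 < θ →
          ∀ᶠ N in atTop, (Nat.card {i : Fin N // ¬ LayeredGood 2 η (x N) i} : ℝ) ≤ θ * N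

/-! ### The declared stubs (the only `sorry`s of the file) -/

/-- **Stub 1 — grain-boundary tension of rigid Lennard-Jones polycrystals (THE NEW INPUT; configuration-free).**  For SOME
fineness `κ > 0` (grains as coarse as the proof likes) and every tolerance `η₁ > 0` there are `g₀ > 0` and `C` such that
for every polycrystal template `T` of `1/κ`-fat convex cells, each filled by its own rigid admissible layered grain, every
finite window `W ⊆ T` satisfies `Σ_{p∈W} e_p(T) ≥ 2e⋆·#W + 2g₀·#{p ∈ W : ¬ SetLayeredNearR 3 η₁ T p} − C·∂W`: every
JUNCTION point (the polycrystal is genuinely not single-frame on its 3-ball) pays a uniform surplus `g₀` over the bulk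
value `2e⋆`, window-averaged (over- and under-coordinated interface points are averaged, hence the `−C∂W` slack and no
per-site claim).  Intended proof (`V(r) = r⁻¹²/12 − r⁻⁶/6`): (o) GEOMETRY: fat cells with pairwise distinct affine
functions meet a unit ball at most `43` at a time (each brings a disjoint ball of radius `2` inside the concentric ball
of radius `7`, by convexity), so `T` has uniformly bounded local density and all site-energy tails are uniform;
(i) BASELINE for free: `Σ_W e_p(T) = 2E(W) + X(W, T∖W) ≥ 2e⋆·#W − C∂W` by `card_mul_eStar_le` and `V ≥ −1/12`, tails
`r⁻⁶` (so the inequality never needs the unknown value of `e⋆` from below); (ii) SURPLUS: since `e⋆ ≤ m` for the energy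
density `m` of any admissible layered competitor, it suffices to prove the inequality with `2e⋆` replaced by twice the
infimal energy density of the admissible layered family — a statement purely about rigid polycrystals of Barlow-box
grains versus the best single Barlow-box crystal: a layer-by-layer CALIBRATION inside each grain (a corrector along the
one-dimensional gap/Hägg chain making the corrected site energy pointwise `≥ 2m`, ergodic-optimisation sub-action) plus
INTERFACE EXCESS `≥ 2g₀` per junction point for pairs / triples / corners of rigid misfitting grains (compact family of
local pictures at tolerance `η₁`: misorientations in `SO(3)`, inclinations, rigid shifts, cut offsets, local spacings,
gaps and Hägg letters; certified interval lattice sums on a finite net where analysis does not decide, Lipschitz in the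
data).  Physics: the UNRELAXED energy of every genuine grain boundary of a close-packed Lennard-Jones crystal, optimised
over rigid translations, is positive (Read–Shockley for small angles — rigid grains cannot even form the dislocation wall,
misfit strain accumulates; cusped but positive for special CSL boundaries; the coherent twin, the only computed zero, is a
Hägg flip, i.e. junction-free).  May fail through a special rigid interface (coincidence-site boundary with its optimal
rigid shift and cut, or a triple-line / corner picture of fat grains) whose junction points have window-averaged site
energy `≤ 2m` — a polycrystalline arrangement of admissible layered grains locally tying the best layered crystal, unknown
to every grain-boundary-energy survey — or if no layer calibration with exact constant `2m` exists for inhomogeneous gap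
sequences (first-order dips of single-site energies below `2m` next to favourable gaps are real, `≈ 0.004`; they must be
absorbed by the neighbouring layers' first-shell costs `≈ 0.02`). [conjecture] -/
theorem stub_grainTension : ∃ κ : ℝ, 0 < κ ∧ TensionAt κ := by
  sorry

/-- **Stub 2 — junction-free template points carry layered-good particles (potential-free; the cheap end).**  If the
`R'`-ball around `x i` is two-way `η'`-matched with a polycrystal template `T` (`η' ≤ 1/4`), `x j` is a particle with
`‖x j − x i‖ + 3 ≤ R'` matched to the template point `p` (`dist ≤ η'`), and `T` is single-frame on the `3`-ball of `p` at
tolerance `η₁ ≤ 1/4` (`SetLayeredNearR 3 η₁ T p`, datum `(A, t, a, s, z)`), then `x j` is `(2, 2(η₁+η'))`-layered-good.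
Intended proof: let `A (layeredPos a s z l₀)` be the template point `η₁`-close to `p + t`; RE-ANCHOR there: the set
`S := A '' range (layeredPos a s' z')` with the shifted word `s' k = s (k + l₀.1)` and heights `z' k = z (k + l₀.1) − z l₀.1`
equals `{A (layeredPos a s z l) − A (layeredPos a s z l₀)}` (`layeredPos_shift`, `InBox.shift`, `isHaggSeq_shift` of the
landed gluing files) and is an admissible CENTRED layered set as in `LayeredGood`; a particle within `2` of `x j` is within
`R'` of `x i`, hence `η'`-matched to a point `y ∈ T` with `dist y p ≤ 2 + 2η' ≤ 3`, hence `y + t` is `η₁`-close to some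
`A (layeredPos a s z l)`, so `x k − x j` is `(2η₁ + 2η')`-close to `A (layeredPos … l) − A (layeredPos … l₀) ∈ S`;
conversely a point of `S` of norm `≤ 2` comes from `A (layeredPos … l)` within `2 + η₁ ≤ 3` of `p + t`, matched to some
`y ∈ T` with `‖y‖ ≤ ‖x j − x i‖ + 3 ≤ R'`, matched to a particle.  May fail only through an indexing slip in the
re-anchoring. [folklore] -/
theorem stub_junctionTransfer :
    ∀ (κ R' η' η₁ : ℝ), 0 < η' → η' ≤ 1 / 4 → 0 < η₁ → η₁ ≤ 1 / 4 →
      ∀ (N : ℕ) (x : Fin N → E3) (i j : Fin N) (T : PolyTemplate) (p : E3),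
        PolyGoodVia κ R' η' x i T → ‖x j - x i‖ + 3 ≤ R' → p ∈ T.carrier → dist (x j - x i) p ≤ η' →
        SetLayeredNearR 3 η₁ T.carrier p → LayeredGood 2 (2 * (η₁ + η')) x j := by
  sorry

/-- **Stub 3 — grain coarsening along ground states (Lennard-Jones block accounting; load-bearing).**  At any fineness
`κ > 0` where the tension inequality holds, and given the transfer lemma: along every sequence of Lennard-Jones ground
states whose `κ`-grain-blind defects are sparse at every scale (`FewGrainBad κ`), the SINGLE-FRAME defects are sparse too
— for every `η, θ > 0`, eventually at most `θN` sites are not two-way `(2, η)`-layered-good.  Intended proof: `η₁ := η/4`;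
`g₀, C` from `TensionAt κ`; cubes of side `B` with `C·B² ≤ g₀θB³/8`; accounting scale `R' ≥ 4B` with tails
`≤ g₀θ/8`; matching tolerance `η' ≤ min (η/4) (δ/4)` (`δ` = minimal distance of ground states) so small that the
template-vs-particle perturbation `ω(η', R')` of cube energies (Lipschitz bound of `V` on `[δ/2, ∞)`, at most `43·C_a R'³`
pairs, uniform over fat templates by bounded density) is `≤ g₀θ/8`; by `FewGrainBad κ` eventually all but `θ'N` sites are
`κ`-grain-good at `(R', η')`, and a layered-good site is polycrystal-good for the one-cell template (`polyGood_of_layeredGood`,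
`κ > 0`), so every good site `i` carries a fat template `T_i` two-way `η'`-matched on its `R'`-ball, particles and template
points in BIJECTION there (`η' < δ/4`); by Stub 2 (contrapositive) a particle `j` of that ball with `¬ LayeredGood 2 η (x N) j`
is matched to a JUNCTION point of `T_i` (`η ≥ 2(η₁ + η')`); ENERGY per cube `Q` with a good site: `Σ_{j∈Q} ½·siteE_j(x_N) ≥
½ Σ_{p∈W_Q} e_p(T_i) − #Q·ω ≥ #Q·e⋆ + g₀·#{junction particles in Q} − C·B² − #Q·ω` (`W_Q` = matched template points,
Stub 1); cubes without a good site hold only `θ'`-budgeted sites, each with `½·siteE ≥ −C₀(δ)`; summing and comparing with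
`E(x_N) ≤ N(e⋆ + ε)` eventually (`crysEnergyLimit`, `(hx N).2`): `g₀·#{j ∣ ¬ LayeredGood 2 η (x N) j} ≤ N(ε + ω + C/B) +
(C₀ + |e⋆| + g₀)·θ'N ≤ θ·g₀·N` for `θ'`, `ε` small.  May fail through the bookkeeping of cubes meeting the `R'`-balls of
two good sites with DIFFERENT templates (each cube is accounted with ONE template; the two-way matching on the big ball
makes the choice immaterial, the junction predicate at tolerance `η₁ = η/4` absorbing the `2η'` ambiguity — which is why
Stub 1 is asked for every `η₁`), or if `ω` were not uniform over fat templates (it is: (o) of Stub 1). [conjecture] -/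
theorem stub_grainCoarsening :
    ∀ κ : ℝ, 0 < κ → TensionAt κ → Sig.stub_junctionTransfer →
      ∀ x : (N : ℕ) → (Fin N → E3), (∀ N, IsGroundState lennardJones (x N)) → FewGrainBad κ x →
        ∀ η θ : ℝ, 0 < η → 0 < θ →
          ∀ᶠ N in atTop, (Nat.card {i : Fin N // ¬ LayeredGood 2 η (x N) i} : ℝ) ≤ θ * N := by
  sorry

/-! ### Sorry-free glue -/

/-- **Counting** (the seed's `eventually_exists_not_bad` with a density): under FLOOR(P₀) (`e(P₀) = e⋆`,
`floor_iff_eq_eStar`) and the `κ`-grain-blind budget, `c·#bad ≤ E(N) − N·e⋆` and `E(N)/N → e⋆` (`crysEnergyLimit`) give,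
for every `θ > 0`, eventually `#bad ≤ θN`. [folklore] -/
theorem fewGrainBad_of_budget (κ : ℝ) (P₀ : PeriodicConfiguration 3) (hF : Floor P₀) (hB : GrainBudget κ P₀)
    (x : (N : ℕ) → (Fin N → E3)) (hx : ∀ N, IsGroundState lennardJones (x N)) : FewGrainBad κ x := by
  intro R η θ hR hη hθ
  obtain ⟨c, hc, hcB⟩ := hB R η hR hη
  have heq := (Theorems.FluxTubeKeplerFloorGivesLayered.floor_iff_eq_eStar P₀).1 hF
  have hlim := crysEnergyLimit
  have hlt : (⨅ Q : PeriodicConfiguration 3, Q.energyPerParticle lennardJones) < eStar + c * θ := by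
    change eStar < eStar + c * θ
    nlinarith
  have hev : ∀ᶠ N : ℕ in atTop, groundStateEnergy lennardJones 3 N / N < eStar + c * θ :=
    hlim.eventually (gt_mem_nhds hlt)
  filter_upwards [hev, Filter.eventually_gt_atTop 0] with N hN hNpos
  have h1 := hcB N (x N) (hx N)
  rw [heq, (hx N).2] at h1
  have hNr : (0 : ℝ) < N := by exact_mod_cast hNpos
  have h2 : groundStateEnergy lennardJones 3 N < (eStar + c * θ) * N := by
    rwa [div_lt_iff₀ hNr] at hN
  have h3 : c * (Nat.card {i : Fin N // ¬ GrainGood κ R η (x N) i} : ℝ) < c * (θ * N) := by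
    nlinarith
  exact (lt_of_mul_lt_mul_left h3 hc.le).le

/-- (Verbatim from the sibling lines `Lines/RegistryBlindRung.lean`, `Lines/ScaleBlindRung.lean`.)  **Sparse radius-`2`
single-frame defects ⇒ good sites at every scale, frequently** (landed chart gluing `FluxCellKeplerSingleScale.card_bad_le`
at `R₀ = 2`, `δ`-separation of ground states `LennardJonesMinimalDistance_holds`, and counting). [folklore] -/
theorem good_of_sparse (x : (N : ℕ) → (Fin N → E3)) (hx : ∀ N, IsGroundState lennardJones (x N))
    (hsp : ∀ η θ : ℝ, 0 < η → 0 < θ →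
      ∀ᶠ N in atTop, (Nat.card {i : Fin N // ¬ LayeredGood 2 η (x N) i} : ℝ) ≤ θ * N) :
    ∀ R η : ℝ, 0 < R → 0 < η → ∃ᶠ N in atTop, ∃ i : Fin N, LayeredGood R η (x N) i := by
  intro R η hR hη
  obtain ⟨δ, hδ, hsep⟩ := LennardJonesMinimalDistance_holds
  obtain ⟨η', hη', M, hM, hcard⟩ := card_bad_le (le_refl (2 : ℝ)) hδ R η hη
  have hθ : (0 : ℝ) < 1 / (2 * M) := by positivity
  have hev := (hsp η' (1 / (2 * M)) hη' hθ).and (eventually_ge_atTop 1)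
  refine hev.frequently.mono fun N hN => ?_
  obtain ⟨hNsp, hN1⟩ := hN
  by_contra hno
  have hno' : ∀ i : Fin N, ¬ LayeredGood R η (x N) i := fun i hi => hno ⟨i, hi⟩
  have hall : (N : ℝ) ≤ Nat.card {i : Fin N // ¬ LayeredGood R η (x N) i} := by
    rw [Nat.card_eq_fintype_card, Fintype.card_subtype]
    have : (Finset.univ.filter fun i : Fin N => ¬ LayeredGood R η (x N) i) = Finset.univ :=
      Finset.filter_true_of_mem fun i _ => hno' i
    rw [this, Finset.card_univ, Fintype.card_fin]
  have h1 := hcard N (x N) (hsep N (x N) (hx N))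
  have hN1' : (1 : ℝ) ≤ N := by exact_mod_cast hN1
  have hchain : (N : ℝ) ≤ M * (1 / (2 * M) * N) := hall.trans (h1.trans (mul_le_mul_of_nonneg_left hNsp hM.le))
  have hMM : M * (1 / (2 * M) * N) = N / 2 := by field_simp
  rw [hMM] at hchain
  linarith

open Summit.AtomisticToContinuum.Crystallization.Theorems.FluxTubeKeplerFloorGivesLayered
  (spacing_selection match_dilate layered_pt_scale) in
/-- (Verbatim from the sibling lines `Lines/PosTolRung.lean`, `Lines/VacancyBlindRung.lean`,
`Lines/RegistryBlindRung.lean`, `Lines/ScaleBlindRung.lean`.)  Steps 2–3 of the seed, isolated: good sites at every scale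
(with scale-dependent spacings IN THE BOX) give the layered-windows hypothesis of `FluxTubeKepler.PeriodicGivenLayered`
(one spacing by `spacing_selection` — Bolzano–Weierstrass on the compact box, transfer by dilation `match_dilate` +
`layered_pt_scale`, translation `t := −x N i`). [folklore] -/
theorem hasLayeredWindows_of_good (x : (N : ℕ) → (Fin N → E3))
    (hgood : ∀ R η : ℝ, 0 < R → 0 < η → ∃ᶠ N in atTop, ∃ i : Fin N, LayeredGood R η (x N) i) :
    ∃ a : ℝ, 47 / 50 ≤ a ∧ a ≤ 1 ∧ ∀ R ε : ℝ, 0 < ε → ∃ᶠ N in Filter.atTop,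
      ∃ (A : E3 →ₗᵢ[ℝ] E3) (t : E3) (s : ℤ → ℤ) (z : ℤ → ℝ), IsHaggSeq s ∧
      (∀ m : ℤ, 39 / 50 * a ≤ z (m + 1) - z m ∧ z (m + 1) - z m ≤ 17 / 20 * a) ∧
      let S : Set E3 := {p | ∃ m i j : ℤ, p = A (((i : ℝ) • triangularVec₁ a) +
        ((j : ℝ) • triangularVec₂ a) + ((haggLabel s m : ℝ) • barlowOffset a) + (z m • layerNormal 1))};
      (∀ p ∈ S, ‖p‖ ≤ R → ∃ i : Fin N, dist (x N i + t) p ≤ ε) ∧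
      (∀ i : Fin N, ‖x N i + t‖ ≤ R → ∃ p ∈ S, dist (x N i + t) p ≤ ε) := by
  -- Step 2: one spacing for all scales, the transfer being dilation of the whole layered datum
  have hgood' : ∀ R η : ℝ, 0 < R → 0 < η → ∃ᶠ N in atTop, ∃ i : Fin N, ∃ a : ℝ, 47 / 50 ≤ a ∧ a ≤ 1 ∧
      ∃ (A : E3 →ₗᵢ[ℝ] E3) (s : ℤ → ℤ) (z : ℤ → ℝ), IsHaggSeq s ∧
        (∀ m : ℤ, 39 / 50 * a ≤ z (m + 1) - z m ∧ z (m + 1) - z m ≤ 17 / 20 * a) ∧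
        let S : Set E3 := {p | ∃ m k l : ℤ, p = A (((k : ℝ) • triangularVec₁ a) +
          ((l : ℝ) • triangularVec₂ a) + ((haggLabel s m : ℝ) • barlowOffset a) + (z m • layerNormal 1))};
        (∀ p ∈ S, ‖p‖ ≤ R → ∃ j : Fin N, dist (x N j - x N i) p ≤ η) ∧
        (∀ j : Fin N, ‖x N j - x N i‖ ≤ R → ∃ p ∈ S, dist (x N j - x N i) p ≤ η) := hgood
  obtain ⟨a, ha1, ha2, hwin⟩ := spacing_selection hgood' fun R ε hR hε => by
    obtain ⟨η₁, hη₁0, hη₁ε, hη₁1⟩ : ∃ η₁ : ℝ, 0 < η₁ ∧ η₁ ≤ ε ∧ η₁ ≤ 1 :=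
      ⟨min ε 1, lt_min hε one_pos, min_le_left _ _, min_le_right _ _⟩
    have hR1 : 0 < R + 1 := by linarith
    obtain ⟨θ, hθ0, hθR⟩ : ∃ θ : ℝ, 0 < θ ∧ θ * (R + 1) = η₁ / 2 :=
      ⟨η₁ / 2 / (R + 1), by positivity, by field_simp⟩
    refine ⟨47 / 50 * θ, by positivity, R + 1, η₁ / 2, by positivity, ?_⟩
    intro a b R' η' ha hb hab hRR' hη' N i hG
    obtain ⟨A, s, z, hs, hbox, hM₁, hM₂⟩ := hG
    have ha0 : 0 < a := by linarith
    have hb0 : 0 < b := by linarith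
    obtain ⟨ρ, hρ0, hρb⟩ : ∃ ρ : ℝ, 0 < ρ ∧ ρ * b = a :=
      ⟨a / b, div_pos ha0 hb0, div_mul_cancel₀ a hb0.ne'⟩
    have habs : |b - a| < 47 / 50 * θ := hab
    have h1ρ : |1 - ρ| ≤ θ := by
      have e1 : 1 - ρ = (b - a) / b := by rw [← hρb]; field_simp
      rw [e1, abs_div, abs_of_pos hb0, div_le_iff₀ hb0]
      nlinarith [abs_nonneg (b - a)]
    have h1ρ' : |ρ⁻¹ - 1| ≤ θ := by
      have e1 : ρ⁻¹ - 1 = (b - a) / a := by rw [← hρb]; field_simp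
      rw [e1, abs_div, abs_of_pos ha0, div_le_iff₀ ha0]
      nlinarith [abs_nonneg (b - a)]
    refine ⟨A, s, fun m => ρ * z m, hs, fun m => ?_, ?_⟩
    · obtain ⟨hl, hu⟩ := hbox m
      have hl' := mul_le_mul_of_nonneg_left hl hρ0.le
      have hu' := mul_le_mul_of_nonneg_left hu hρ0.le
      constructor
      · calc 39 / 50 * a = ρ * (39 / 50 * b) := by rw [← hρb]; ring
          _ ≤ ρ * (z (m + 1) - z m) := hl'
          _ = ρ * z (m + 1) - ρ * z m := by ring
      · calc ρ * z (m + 1) - ρ * z m = ρ * (z (m + 1) - z m) := by ring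
          _ ≤ ρ * (17 / 20 * b) := hu'
          _ = 17 / 20 * a := by rw [← hρb]; ring
    · have hscale : ∀ m k l : ℤ, A (((k : ℝ) • triangularVec₁ a) + ((l : ℝ) • triangularVec₂ a) +
          ((haggLabel s m : ℝ) • barlowOffset a) + ((ρ * z m) • layerNormal 1)) =
          ρ • A (((k : ℝ) • triangularVec₁ b) + ((l : ℝ) • triangularVec₂ b) +
          ((haggLabel s m : ℝ) • barlowOffset b) + (z m • layerNormal 1)) := by
        intro m k l
        rw [← hρb]
        exact layered_pt_scale A ρ b s z m k l
      dsimp only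
      refine match_dilate (fun j => x N j - x N i) _ _ hθ0 hθR hη₁ε hη₁1 hρ0 h1ρ h1ρ' hRR' hη'
        ?_ ?_ hM₁ hM₂
      · rintro p ⟨m, k, l, rfl⟩
        exact ⟨m, k, l, (hscale m k l).symm⟩
      · rintro p' ⟨m, k, l, rfl⟩
        exact ⟨_, ⟨m, k, l, rfl⟩, hscale m k l⟩
  -- Step 3: read the fixed-spacing good site at radius `max R 1` and translate by `t := -x N i`
  refine ⟨a, ha1, ha2, fun R ε hε => ?_⟩
  have hR' : 0 < max R 1 := lt_max_of_lt_right one_pos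
  refine (hwin (max R 1) ε hR' hε).mono fun N hN => ?_
  obtain ⟨i, hi⟩ := hN
  obtain ⟨A, s, z, hs, hbox, hM₁, hM₂⟩ := hi
  refine ⟨A, -x N i, s, z, hs, hbox, ?_⟩
  have hsub : ∀ j : Fin N, x N j + -x N i = x N j - x N i := fun j =>
    (sub_eq_add_neg (x N j) (x N i)).symm
  intro S
  refine ⟨fun p hp hpR => ?_, fun j hj => ?_⟩
  · obtain ⟨j, hj⟩ := hM₁ p hp (hpR.trans (le_max_left R 1))
    exact ⟨j, by rw [hsub j]; exact hj⟩
  · rw [hsub j] at hj ⊢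
    exact hM₂ j (hj.trans (le_max_left R 1))

/-! ### The skeleton theorem: the rung BY NAME from the three stub statements (sorry-free) -/

/-- **Assembly.** `stub_grainTension → stub_junctionTransfer → stub_grainCoarsening → GrainBlindRung`: the tension stub
names the fineness `κ > 0`; under FLOOR and the `κ`-grain-blind budget the `κ`-grain-blind defects are sparse at every scale
(`fewGrainBad_of_budget`); stubs 1+2+3 make the radius-`2` single-frame defects sparse along the sequence (grain
coarsening); the landed chart gluing turns sparsity into single-frame good sites at every scale (`good_of_sparse`), hence
layered windows (`hasLayeredWindows_of_good`) and periodic windows (proved `PeriodicGivenLayered`). -/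
theorem GrainBlindRung_of (h₁ : Sig.stub_grainTension) (h₂ : Sig.stub_junctionTransfer)
    (h₃ : Sig.stub_grainCoarsening) : GrainBlindRung := by
  obtain ⟨κ, hκ, hT⟩ := h₁
  refine ⟨κ, hκ, fun P₀ hF hB x hx => ?_⟩
  have hsp := h₃ κ hκ hT h₂ x hx (fewGrainBad_of_budget κ P₀ hF hB x hx)
  have hgood := good_of_sparse x hx hsp
  exact Theses.FluxTubeKepler.PeriodicGivenLayered_holds x hx (hasLayeredWindows_of_good x hgood)

/-- **The closed skeleton instance**: the rung by name from the three declared stubs (the only `sorry`s of this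
file enter here). [conjecture] -/
theorem GrainBlindRung_skeleton : GrainBlindRung :=
  GrainBlindRung_of stub_grainTension stub_junctionTransfer stub_grainCoarsening

end Summit.AtomisticToContinuum.Crystallization.Cruxes.FluxCellKepler.GrainLadder

end
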